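import Summits.QuantumFields.QCD.Theses.EulerDescent
import Literature.MathematicalPhysics.QuantumFieldTheory.QCDCurrentSector
import Summits.QuantumFields.QCD.Theorems.EulerDescentChiralCornerSoftnessStubSlabFluxBound
import Literature.MathematicalPhysics.QuantumFieldTheory.QCDPhaseQuenched
import Literature.MathematicalPhysics.QuantumFieldTheory.Multiboson
import Literature.MathematicalPhysics.QuantumLattice.GrassmannIntegralGaussianProofs
import Literature.Barriers.QuantumFields.WilsonDeterminantMassSplitting
import Literature.Barriers.QuantumFields.WilsonDeterminantSign
import HarnessLib

/-!
# Sub-goal `stub_condensateFluxFloor_nondegTwo` of stub E3 (`stub_condensateFluxFloor`) of line `Sketch`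
(crux `Summit.QuantumFields.QCD.Theses.EulerDescent.ChiralCornerSoftness`, item stmt-QuantumFields-16902)

**The denominator of the twisted torus expectation never vanishes for `N_f = 2`.**  For the twisted-mass Wilson
doublet `(f, g)`, `f ≠ g` in `Fin 2` (so that EVERY flavour is twisted), at any inverse coupling `β`, degenerate bare
mass `m₀`, twisted mass `μ ≠ 0` and torus side `2S+1`, the gauge average of the Berezin weight
`Z(β, m₀, μ, S) = ∫dμ_W(U) ∫dψ̄dψ e^{−ψ̄(D_W(U,m₀) ⊗ 1 + iμγ₅ ⊗ τ³)ψ}` is REAL and STRICTLY POSITIVE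
(`twDenominator_two_re_pos`), in particular `≠ 0` (`stub_condensateFluxFloor_nondegTwo`, the registered signature:
the `let Tw` is textually the skeleton's twisted-mass matrix at `Nf := 2`).  So the expectations `E = num / Z` of E3 are
never Lean-junk `x / 0`.

## Proof (everything is proved; no named fact is taken as a hypothesis)

* `fermiIntegral_grassmannExp_quadratic_neg` — the Berezin Gaussian integral of the torus quark algebra has orientation
  sign `+1`: `∫dψ̄dψ e^{−ψ̄Mψ} = (−1)^{n(n−1)/2}·det(−M) = (−1)^{n(n−1)/2 + n} det M = det M`, because the number of quark
  variables `n = N_f · |Λ| · 3 · 4` is a multiple of `4` (tree: `berezin_grassmannExp_quadratic_holds`,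
  Montvay–Münster (4.17)/(4.22)).
* `diracQ_add_twistQ`, `det_flavDiag` — the twisted Dirac matrix on quark variables is flavour-block-diagonal with blocks
  `D_W + s_{f'}·iμ Γ₅` (`Γ₅ = 1 ⊗ 1 ⊗ γ₅`, `s = +1, −1` on `f, g`), so its determinant is the product of the block
  determinants; `det (reindex e e M) = det M`.
* `det_wilsonDirac_add_smul_spinorLift` — `D_W + cΓ₅ = Γ₅(Γ₅D_W + c)` and `det Γ₅ = 1`, so
  `det(D_W ± iμΓ₅) = det(Q ± iμ)` with the Hermitian Wilson operator `Q = Γ₅ D_W`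
  (`isHermitian_gammaFive_mul_wilsonDirac_fundamental`).
* `fermiIntegral_twWeight_two` — for `N_f = 2`: weight `= det(Q + iμ) det(Q − iμ) = det(Q² + μ²)` (`det_twisted_eq`),
  which is `> 0` on EVERY gauge field for `μ ≠ 0` (`det_twisted_pos`, Mohler–Schaefer §2.3 / Frezzotti–Grassi–Sint–Weisz
  §2.1: the twisted doublet has no zero modes).
* `twDenominator_two_re_pos` — the weight is integrable (`coeffRegular_twWeight`, `integrable_fermiIntegral` of E1) and
  pointwise real positive, and the Wilson measure is a probability measure, so `Re Z > 0`, `Im Z = 0`.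

References: I. Montvay, G. Münster, *Quantum Fields on a Lattice* (CUP 1994), §4.1.3 (4.17)–(4.22) (Gaussian Grassmann
integral), §5.1.2 (5.15)–(5.16) (`γ₅`-Hermiticity); R. Frezzotti, P. A. Grassi, S. Sint, P. Weisz, JHEP 08 (2001) 058,
§2.1 (twisted-mass lattice QCD: `det(Q² + μ²) > 0`); D. Mohler, S. Schaefer, Phys. Rev. D 102 (2020) 074506, §2.3.
-/

noncomputable section

namespace Summit.QuantumFields.QCD.Cruxes.ChiralCornerSoftness.TwistedRay

open Filter Topology MeasureTheory
open Literature.MathematicalPhysics.QuantumFieldTheory Literature.MathematicalPhysics.QuantumLattice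
  Literature.Probability.LatticeModels
open scoped ComplexOrder

namespace NondegTwo

open SlabFluxWard

/-! ### The orientation sign of the torus Berezin Gaussian integral is `+1` -/

section Orientation

variable {Nf L : ℕ} [NeZero L]

/-- `n(n−1)/2 + n` is even when `4 ∣ n`. [folklore] -/
theorem even_orientation_exponent {n : ℕ} (h : 4 ∣ n) : Even (n * (n - 1) / 2 + n) := by
  obtain ⟨k, rfl⟩ := h
  refine Even.add ?_ ⟨2 * k, by ring⟩
  generalize 4 * k - 1 = j
  have h2 : 4 * k * j = 2 * (2 * (k * j)) := by ring
  rw [h2, Nat.mul_div_cancel_left _ two_pos]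
  exact even_two_mul _

/-- The number of quark variables `n = N_f · |Λ| · 3 · 4` of the torus is a multiple of `4`. [folklore] -/
theorem four_dvd_card_fermiIdx : 4 ∣ Fintype.card (FermiIdx Nf L) := by
  simp only [Fintype.card_fin, Fintype.card_prod]
  exact Dvd.dvd.mul_left (Dvd.dvd.mul_left (Dvd.dvd.mul_left (dvd_refl 4) _) _) _

/-- **The fermionic Gaussian integral of the torus quark algebra with its sign**:
`∫dψ̄dψ e^{−ψ̄Mψ} = det M` — the tree's Berezin formula `∫ e^{ψ̄Aψ} = (−1)^{n(n−1)/2} det A` at `A = −M`,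
`det(−M) = (−1)^n det M`, and `(−1)^{n(n−1)/2 + n} = 1` since `4 ∣ n`. [cite: MontvayMunster1994, §4.1.3 (4.17)–(4.22)] -/
theorem fermiIntegral_grassmannExp_quadratic_neg (M : Matrix (FermiIdx Nf L) (FermiIdx Nf L) ℂ) :
    fermiIntegral (grassmannExp (quadratic ℂ (-M))) = M.det := by
  simp only [fermiIntegral]
  rw [berezin_grassmannExp_quadratic_holds ℂ (ι := FermiIdx Nf L) (-M), Matrix.det_neg, ← mul_assoc, ← pow_add,
    (even_orientation_exponent four_dvd_card_fermiIdx).neg_one_pow, one_mul]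

end Orientation

/-! ### The twisted Dirac matrix is flavour-block-diagonal; its blocks are `Γ₅ (Q ± iμ)` -/

section Blocks

variable {Nf L : ℕ} [NeZero L]

omit [NeZero L] in
/-- The site–colour-diagonal twist block is `iμ · Γ₅`, `Γ₅ = 1 ⊗ 1 ⊗ γ₅`. [folklore] -/
theorem twistBlock_eq_smul_spinorLift (μl : ℝ) :
    twistBlock (L := L) μl = ((μl : ℂ) * Complex.I) •
      (spinorLift gammaFive : Matrix (TorusSite 4 L × Fin 3 × Fin 4) (TorusSite 4 L × Fin 3 × Fin 4) ℂ) := by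
  ext ⟨x, a, α⟩ ⟨y, b, β'⟩
  simp only [twistBlock, spinorLift, Matrix.of_apply, Matrix.smul_apply, Matrix.kronecker_apply, Matrix.one_apply,
    smul_eq_mul]
  by_cases hx : x = y <;> by_cases ha : a = b <;> simp [hx, ha]

omit [NeZero L] in
/-- Flavour-diagonal matrices add blockwise. [folklore] -/
theorem flavDiag_add (F G : Fin Nf → Matrix (TorusSite 4 L × Fin 3 × Fin 4) (TorusSite 4 L × Fin 3 × Fin 4) ℂ) :
    flavDiag F + flavDiag G = flavDiag (F + G) := by
  ext v w
  simp only [flavDiag, Matrix.add_apply, Matrix.of_apply, Pi.add_apply]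
  split_ifs <;> simp

/-- **The determinant of a flavour-diagonal matrix is the product of its flavour blocks.** [folklore] -/
theorem det_flavDiag (F : Fin Nf → Matrix (TorusSite 4 L × Fin 3 × Fin 4) (TorusSite 4 L × Fin 3 × Fin 4) ℂ) :
    (flavDiag F).det = ∏ f, (F f).det := by
  have h : flavDiag F =
      Matrix.reindex (Equiv.prodComm _ _) (Equiv.prodComm _ _) (Matrix.blockDiagonal F) := by
    ext ⟨f, i⟩ ⟨g, j⟩
    simp only [flavDiag, Matrix.of_apply, Matrix.reindex_apply, Matrix.submatrix_apply, Equiv.prodComm_symm,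
      Equiv.prodComm_apply, Prod.swap_prod_mk, Matrix.blockDiagonal_apply']
  rw [h, Matrix.det_reindex_self, Matrix.det_blockDiagonal]

omit [NeZero L] in
/-- **The twisted Dirac matrix on quark variables is flavour-block-diagonal** with blocks
`D_W(U, m₀) + s_{f'} · iμ Γ₅`, `s = (+1 on f, −1 on g, 0 else)`. [cite: FrezzottiGrassiSintWeisz2001, §2.1] -/
theorem diracQ_add_twistQ (U : GaugeConfig 4 L (Matrix.specialUnitaryGroup (Fin 3) ℂ)) (m₀ μl : ℝ)
    (f g : Fin Nf) :
    diracQ U m₀ + twistQ f g μl = flavDiag fun f' =>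
      wilsonDirac (fundamentalRep (Fin 3)) U m₀ 1 +
        (twSign f g f' * ((μl : ℂ) * Complex.I)) •
          (spinorLift gammaFive : Matrix (TorusSite 4 L × Fin 3 × Fin 4) (TorusSite 4 L × Fin 3 × Fin 4) ℂ) := by
  rw [twistQ_eq_flavDiag, diracQ, flavDiag_add]
  congr 1
  funext f'
  rw [Pi.add_apply, twistBlock_eq_smul_spinorLift, smul_smul]

/-- `det(D_W + cΓ₅) = det(Γ₅ D_W + c)`: `D_W + cΓ₅ = Γ₅ (Γ₅ D_W + c·1)` (`Γ₅² = 1`) and `det Γ₅ = 1`. [folklore] -/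
theorem det_wilsonDirac_add_smul_spinorLift (U : GaugeConfig 4 L (Matrix.specialUnitaryGroup (Fin 3) ℂ)) (m₀ : ℝ)
    (c : ℂ) :
    (wilsonDirac (fundamentalRep (Fin 3)) U m₀ 1 +
        c • (spinorLift gammaFive : Matrix (TorusSite 4 L × Fin 3 × Fin 4) (TorusSite 4 L × Fin 3 × Fin 4) ℂ)).det =
      (spinorLift gammaFive * wilsonDirac (fundamentalRep (Fin 3)) U m₀ 1 +
        c • (1 : Matrix (TorusSite 4 L × Fin 3 × Fin 4) (TorusSite 4 L × Fin 3 × Fin 4) ℂ)).det := by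
  have hsq := spinorLift_gammaFive_mul_self (L := L) (N := 3)
  have h : wilsonDirac (fundamentalRep (Fin 3)) U m₀ 1 +
      c • (spinorLift gammaFive : Matrix (TorusSite 4 L × Fin 3 × Fin 4) (TorusSite 4 L × Fin 3 × Fin 4) ℂ) =
      spinorLift gammaFive * (spinorLift gammaFive * wilsonDirac (fundamentalRep (Fin 3)) U m₀ 1 + c • 1) := by
    rw [Matrix.mul_add, ← Matrix.mul_assoc, hsq, Matrix.one_mul, Matrix.mul_smul, Matrix.mul_one]
  rw [h, Matrix.det_mul, Literature.Barriers.QuantumFields.WilsonDeterminant.det_spinorLift_gammaFive, one_mul]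

end Blocks

/-! ### `N_f = 2`: the weight is `det(Q² + μ²) > 0` on every gauge field -/

section Two

variable {L : ℕ} [NeZero L]

omit [NeZero L] in
/-- A product over `Fin 2` indexed by a pair `f ≠ g` is the product of the two values. [folklore] -/
theorem prod_univ_two_eq_mul_of_ne {f g : Fin 2} (hfg : f ≠ g) (X : Fin 2 → ℂ) : ∏ f', X f' = X f * X g := by
  rw [Fin.prod_univ_two]
  fin_cases f <;> fin_cases g <;> simp_all [mul_comm]

/-- **The `N_f = 2` twisted Berezin weight at fixed gauge field is `det((Γ₅D_W)² + μ²)`**: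
`∫dψ̄dψ e^{−ψ̄(D_W ⊗ 1 + iμγ₅ ⊗ τ³)ψ} = det(D_W + iμΓ₅) det(D_W − iμΓ₅) = det(Q + iμ) det(Q − iμ) = det(Q² + μ²)`,
`Q = Γ₅ D_W(U, m₀)`. [cite: FrezzottiGrassiSintWeisz2001, §2.1] -/
theorem fermiIntegral_twWeight_two {f g : Fin 2} (hfg : f ≠ g)
    (U : GaugeConfig 4 L (Matrix.specialUnitaryGroup (Fin 3) ℂ)) (m₀ μl : ℝ) :
    fermiIntegral (grassmannExp (quadratic ℂ (-(diracMatrix U (fun _ : Fin 2 => m₀) +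
        Matrix.reindex quarkEquiv quarkEquiv (twistQ f g μl))))) =
      (spinorLift gammaFive * wilsonDirac (fundamentalRep (Fin 3)) U m₀ 1 *
            (spinorLift gammaFive * wilsonDirac (fundamentalRep (Fin 3)) U m₀ 1) +
          ((μl ^ 2 : ℝ) : ℂ) • (1 : Matrix (TorusSite 4 L × Fin 3 × Fin 4) (TorusSite 4 L × Fin 3 × Fin 4) ℂ)).det := by
  have hre : diracMatrix U (fun _ : Fin 2 => m₀) + Matrix.reindex quarkEquiv quarkEquiv (twistQ f g μl) =
      Matrix.reindex quarkEquiv quarkEquiv (diracQ U m₀ + twistQ f g μl) := by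
    rw [diracMatrix_eq_reindex_diracQ]; rfl
  rw [fermiIntegral_grassmannExp_quadratic_neg, hre, Matrix.det_reindex_self, diracQ_add_twistQ, det_flavDiag,
    prod_univ_two_eq_mul_of_ne hfg, det_wilsonDirac_add_smul_spinorLift, det_wilsonDirac_add_smul_spinorLift,
    ← Literature.Barriers.QuantumFields.WilsonSign.det_twisted_eq]
  have hf : twSign f g f = 1 := by simp [twSign]
  have hg : twSign f g g = -1 := by simp [twSign, Ne.symm hfg]
  rw [hf, hg, one_mul, neg_one_mul, neg_smul, ← sub_eq_add_neg]

/-- **The `N_f = 2` twisted weight is strictly positive on EVERY gauge field** for `μ ≠ 0`: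
`det(Q² + μ²) > 0` for the Hermitian `Q = Γ₅ D_W` (no zero modes, no sign sectors). [cite: MohlerSchaefer2020, §2.3] -/
theorem fermiIntegral_twWeight_two_pos {f g : Fin 2} (hfg : f ≠ g)
    (U : GaugeConfig 4 L (Matrix.specialUnitaryGroup (Fin 3) ℂ)) (m₀ : ℝ) {μl : ℝ} (hμ : μl ≠ 0) :
    0 < fermiIntegral (grassmannExp (quadratic ℂ (-(diracMatrix U (fun _ : Fin 2 => m₀) +
        Matrix.reindex quarkEquiv quarkEquiv (twistQ f g μl))))) := by
  rw [fermiIntegral_twWeight_two hfg]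
  exact Literature.Barriers.QuantumFields.WilsonSign.det_twisted_pos
    (isHermitian_gammaFive_mul_wilsonDirac_fundamental U m₀ 1) hμ

/-- **The `N_f = 2` twisted denominator is real and strictly positive**: the gauge average over the Wilson
probability measure of the pointwise positive, integrable weight `det(Q(U)² + μ²)` has positive real part and zero
imaginary part. [cite: FrezzottiGrassiSintWeisz2001, §2.1] -/
theorem twDenominator_two_re_pos {f g : Fin 2} (hfg : f ≠ g) (β m₀ : ℝ) {μl : ℝ} (hμ : μl ≠ 0) (S : ℕ) :
    0 < (∫ U, fermiIntegral (grassmannExp (quadratic ℂ (-(diracMatrix U (fun _ : Fin 2 => m₀) +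
          Matrix.reindex quarkEquiv quarkEquiv (twistQ f g μl)))))
        ∂(wilsonMeasure (d := 4) (L := 2 * S + 1) (fundamentalRep (Fin 3)) β)).re ∧
      (∫ U, fermiIntegral (grassmannExp (quadratic ℂ (-(diracMatrix U (fun _ : Fin 2 => m₀) +
          Matrix.reindex quarkEquiv quarkEquiv (twistQ f g μl)))))
        ∂(wilsonMeasure (d := 4) (L := 2 * S + 1) (fundamentalRep (Fin 3)) β)).im = 0 := by
  set μW := wilsonMeasure (d := 4) (L := 2 * S + 1) (fundamentalRep (Fin 3)) β
  set F : GaugeConfig 4 (2 * S + 1) (Matrix.specialUnitaryGroup (Fin 3) ℂ) → ℂ := fun U =>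
    fermiIntegral (grassmannExp (quadratic ℂ (-(diracMatrix U (fun _ : Fin 2 => m₀) +
      Matrix.reindex quarkEquiv quarkEquiv (twistQ f g μl)))))
  have hint : Integrable F μW := integrable_fermiIntegral (coeffRegular_twWeight m₀ μl f g) μW
  have hpt : ∀ U, 0 < (F U).re ∧ (F U).im = 0 := fun U => by
    have h := Complex.pos_iff.1 (fermiIntegral_twWeight_two_pos hfg U m₀ hμ)
    exact ⟨h.1, h.2.symm⟩
  have hre : (∫ U, F U ∂μW).re = ∫ U, (F U).re ∂μW := by
    simpa only [RCLike.re_to_complex] using (integral_re hint).symm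
  have him : (∫ U, F U ∂μW).im = ∫ U, (F U).im ∂μW := by
    simpa only [RCLike.im_to_complex] using (integral_im hint).symm
  refine ⟨?_, ?_⟩
  · rw [hre]
    have hi : Integrable (fun U => (F U).re) μW := by simpa only [RCLike.re_to_complex] using hint.re
    refine (integral_pos_iff_support_of_nonneg (fun U => (hpt U).1.le) hi).2 ?_
    rw [show Function.support (fun U => (F U).re) = Set.univ from Set.eq_univ_of_forall fun U => (hpt U).1.ne',
      measure_univ]
    exact one_pos
  · rw [him, show (fun U => (F U).im) = fun _ => (0 : ℝ) from funext fun U => (hpt U).2, integral_zero]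

/-- The `N_f = 2` twisted denominator does not vanish. [cite: FrezzottiGrassiSintWeisz2001, §2.1] -/
theorem twDenominator_two_ne_zero {f g : Fin 2} (hfg : f ≠ g) (β m₀ : ℝ) {μl : ℝ} (hμ : μl ≠ 0) (S : ℕ) :
    (∫ U, fermiIntegral (grassmannExp (quadratic ℂ (-(diracMatrix U (fun _ : Fin 2 => m₀) +
          Matrix.reindex quarkEquiv quarkEquiv (twistQ f g μl)))))
        ∂(wilsonMeasure (d := 4) (L := 2 * S + 1) (fundamentalRep (Fin 3)) β)) ≠ 0 := by
  intro h0
  have h := (twDenominator_two_re_pos hfg β m₀ hμ S).1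
  rw [h0, Complex.zero_re] at h
  exact lt_irrefl _ h

end Two

end NondegTwo

open NondegTwo in
/-- **Registered sub-goal `stub_condensateFluxFloor_nondegTwo` of stub E3 (`stub_condensateFluxFloor`): the
denominator of the twisted torus expectation never vanishes for `N_f = 2`.**  For `f ≠ g` in `Fin 2`, every
`β`, `m₀`, `μ ≠ 0` and torus side `2S+1`,
`∫dμ_W(U) ∫dψ̄dψ e^{−ψ̄(D_W(U,m₀) ⊗ 1 + iμγ₅ ⊗ τ³)ψ} ≠ 0` — indeed it is real and `> 0`
(`NondegTwo.twDenominator_two_re_pos`): at fixed `U` the Berezin weight is `det((Γ₅D_W)² + μ²) > 0`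
(`NondegTwo.fermiIntegral_twWeight_two`, `det_twisted_pos`) and the Wilson measure is a probability measure.
The `let Tw` is textually the skeleton's twisted-mass matrix at `Nf := 2`. [cite: FrezzottiGrassiSintWeisz2001, §2.1] -/
theorem stub_condensateFluxFloor_nondegTwo : ∀ (f g : Fin 2), f ≠ g → ∀ (β m₀ μl : ℝ) (S : ℕ), μl ≠ 0 → let Tw := fun (S : ℕ) (μl : ℝ) => Matrix.reindex (quarkEquiv (Nf := 2) (L := 2 * S + 1)) quarkEquiv (Matrix.of fun v w : QuarkVar 2 (2 * S + 1) => if v.1 = w.1 ∧ v.2.1 = w.2.1 ∧ v.2.2.1 = w.2.2.1 then (if v.1 = f then (1 : ℂ) else if v.1 = g then -1 else 0) * ((μl : ℂ) * Complex.I) * gammaFive v.2.2.2 w.2.2.2 else 0); (∫ U, fermiIntegral (grassmannExp (quadratic ℂ (-(diracMatrix U (fun _ : Fin 2 => m₀) + Tw S μl)))) ∂(wilsonMeasure (d := 4) (L := 2 * S + 1) (fundamentalRep (Fin 3)) β)) ≠ 0 := by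
  intro f g hfg β m₀ μl S hμ
  dsimp only
  exact twDenominator_two_ne_zero hfg β m₀ hμ S

end Summit.QuantumFields.QCD.Cruxes.ChiralCornerSoftness.TwistedRay
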